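import Mathlib
import HarnessLib
import Literature.Computability.Complexity.DecisionTree
import Summits.PneNP.PneNP.Theorems.OverlapGapAlgebraSearchHardWindowRungAssembly
import Summits.PneNP.PneNP.Theorems.OverlapGapAlgebraSearchHardWindowTruncationSurrogate
import Summits.PneNP.PneNP.Theorems.OverlapGapAlgebraSearchHardWindowACTailBound

/-!
# PneNP / OverlapGapAlgebra — `SearchHardWindow` (crux stmt-PneNP-2460), Line A: the rungs

The unconditional-modulo-citation rungs of Line A (card `approx-degree-ladder`), all CONDITIONAL on
the single named fact `Literature.Computability.Complexity.HuangSellke2025KSat` (Huang–Sellke 2025,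
arXiv:2501.06427 Cor. 3.21) and otherwise proved from tree material:

* `stub_acZeroRung` — **polynomial-size AC⁰ does not solve random `k`-SAT in the window**: the
  registered stub, = `stub_rungAssembly` (`…RungAssembly.lean`) with its two hypotheses discharged
  by the landed stubs `stub_truncationSurrogate` (Walsh truncation surrogate) and `stub_acTailBound`
  (Tal 2017 tails, `…ACTailBound.lean`);
* `stub_acZeroRungPow` — the same, quantified "for all large `j`" (pull-back along `j ↦ 2^j`);
* `stub_decisionTreeRung` — **bounded-query algorithms fail**: families of decision trees of depth
  `≤ t(n) = o(n)` (one tree per output variable, adaptively querying instance bits) output a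
  satisfying assignment of `F_k(2^j, ⌊α_k 2^j⌋)` for at most an `ε`-fraction of inputs — the class
  rung `shw_classRung` with the EXACT truncation of decision trees
  (`tailWeight_decisionTree_eq_zero`: no Fourier weight above the depth), no switching lemma needed.
  This is the probe model: each output bit may adaptively read at most `t(n) = o(n)` instance bits.

Model: `n = 2^j` variables, `m = ⌊5 · 2^k log k / k · n⌋` clauses of width `k`, instances read as
the `m·k·(j+1)` bits of `litArrayOfBits` (a bijection with `F_k(2^j, m)`, `litArrayEquiv`), success
= the output assignment satisfies the decoded literal array; counting over the uniform cube.

Prover prover-line-stmt-PneNP-2460-0 (line lead), 2026-08-16.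
-/

-- `Summit.PneNP.PneNP.…` is the tree's mandated namespace (summit = sub-problem name).
set_option linter.dupNamespace false

noncomputable section

namespace Summit.PneNP.PneNP.Theorems

open Finset Filter Asymptotics
open Literature.Computability.Complexity
open Literature.Computability.Complexity.LowDegree
open Literature.Probability.RandomGraphs.LowDegree (sgn walsh)
open scoped Classical

/-- **The AC⁰ rung of Line A (registered stub `stub_acZeroRung`, crux stmt-PneNP-2460
`SearchHardWindow`)**, conditional on the named fact `HuangSellke2025KSat` only: there is `k₀` such
that for all `k ≥ k₀`, all depths `d`, size exponents `c` and `ε > 0`, eventually in `n`, whenever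
`n = 2^j` and `m = ⌊5 · 2^k log k / k · n⌋`, every family of `acBasis` circuits of `acDepth ≤ d` and
size `≤ n^c` (one per output variable, reading the `m·k·(j+1)` bits of a literal array) outputs a
satisfying assignment of the decoded instance of `F_k(2^j, m)` for at most `ε · 2^{m k (j+1)}` of
the `2^{m k (j+1)}` inputs. From `stub_rungAssembly` with the landed stubs
`stub_truncationSurrogate` and `stub_acTailBound`. -/
theorem stub_acZeroRung (hLDH : HuangSellke2025KSat) :
    ∃ k₀ : ℕ, ∀ k : ℕ, k₀ ≤ k → ∀ d c : ℕ, ∀ ε : ℝ, 0 < ε →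
      ∀ᶠ n : ℕ in atTop, ∀ j m : ℕ, n = 2 ^ j → m = ⌊5 * 2 ^ k * Real.log k / k * n⌋₊ →
        ∀ C : Fin (2 ^ j) → Circuit (Fin (m * k * (j + 1))),
          (∀ v, (C v).IsOver acBasis ∧ (C v).acDepth ≤ d ∧ (C v).size ≤ n ^ c) →
          ((univ.filter fun x : Fin (m * k * (j + 1)) → Bool =>
              ∀ i : Fin m, ∃ j' : Fin k, (C (litArrayOfBits m k j x i j').1).eval x =
                (litArrayOfBits m k j x i j').2).card : ℝ)
            ≤ ε * 2 ^ (m * k * (j + 1)) :=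
  stub_rungAssembly hLDH (fun D hD g τ hτ => stub_truncationSurrogate D hD g τ hτ) stub_acTailBound

/-- **AC⁰ rung, `j`-form**: the statement of `stub_acZeroRung` for all large numbers `j` of index
bits (`n = 2^j`), pulled back along `j ↦ 2^j → ∞`. Conditional on `HuangSellke2025KSat`. -/
theorem stub_acZeroRungPow (hLDH : HuangSellke2025KSat) :
    ∃ k₀ : ℕ, ∀ k : ℕ, k₀ ≤ k → ∀ d c : ℕ, ∀ ε : ℝ, 0 < ε →
      ∀ᶠ j : ℕ in atTop, ∀ m : ℕ, m = ⌊5 * 2 ^ k * Real.log k / k * (2 ^ j : ℕ)⌋₊ →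
        ∀ C : Fin (2 ^ j) → Circuit (Fin (m * k * (j + 1))),
          (∀ v, (C v).IsOver acBasis ∧ (C v).acDepth ≤ d ∧ (C v).size ≤ (2 ^ j) ^ c) →
          ((univ.filter fun x : Fin (m * k * (j + 1)) → Bool =>
              ∀ i : Fin m, ∃ j' : Fin k, (C (litArrayOfBits m k j x i j').1).eval x =
                (litArrayOfBits m k j x i j').2).card : ℝ)
            ≤ ε * 2 ^ (m * k * (j + 1)) := by
  obtain ⟨k₀, h⟩ := stub_acZeroRung hLDH
  refine ⟨k₀, fun k hk d c ε hε => ?_⟩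
  have hj :=
    (tendsto_pow_atTop_atTop_of_one_lt (one_lt_two : (1 : ℕ) < 2)).eventually (h k hk d c ε hε)
  filter_upwards [hj] with j hj m hm C hC
  exact hj j m rfl hm C hC

/-- **The decision-tree rung (bounded-query algorithms fail)**, conditional on
`HuangSellke2025KSat`: there is `k₀` such that for all `k ≥ k₀`, every query budget
`t(n) = o(n)` and every `ε > 0`, eventually in `n`, whenever `n = 2^j` and
`m = ⌊5 · 2^k log k / k · n⌋`, every family of Boolean decision trees of depth `≤ t(n)` over the
`m·k·(j+1)` instance bits (one tree per output variable) outputs a satisfying assignment of the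
decoded instance for at most `ε · 2^{m k (j+1)}` inputs. The class rung `shw_classRung` at level
`D n = t n + 1` (still `o(n)`), where decision trees of depth `≤ t n` have NO Fourier weight
(`tailWeight_decisionTree_eq_zero`), so the tail hypothesis holds with room to spare. -/
theorem stub_decisionTreeRung (hLDH : HuangSellke2025KSat) :
    ∃ k₀ : ℕ, ∀ k : ℕ, k₀ ≤ k → ∀ t : ℕ → ℕ,
      (fun n : ℕ => (t n : ℝ)) =o[atTop] (fun n : ℕ => (n : ℝ)) → ∀ ε : ℝ, 0 < ε →
      ∀ᶠ n : ℕ in atTop, ∀ j m : ℕ, n = 2 ^ j → m = ⌊5 * 2 ^ k * Real.log k / k * n⌋₊ →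
        ∀ T : Fin (2 ^ j) → DecisionTree (m * k * (j + 1)), (∀ v, (T v).depth ≤ t n) →
          ((univ.filter fun x : Fin (m * k * (j + 1)) → Bool =>
              ∀ i : Fin m, ∃ j' : Fin k, (T (litArrayOfBits m k j x i j').1).eval x =
                (litArrayOfBits m k j x i j').2).card : ℝ)
            ≤ ε * 2 ^ (m * k * (j + 1)) := by
  obtain ⟨k₀, hcls⟩ :=
    shw_classRung hLDH (fun D hD g τ hτ => stub_truncationSurrogate D hD g τ hτ)
  refine ⟨k₀, fun k hk t ht ε hε => ?_⟩
  -- level `t n + 1 = o(n)`, at least `1`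
  have hDo : (fun n : ℕ => ((t n + 1 : ℕ) : ℝ)) =o[atTop] (fun n : ℕ => (n : ℝ)) := by
    have h1 : (fun _ : ℕ => ((1 : ℕ) : ℝ)) =o[atTop] (fun n : ℕ => (n : ℝ)) := by
      have := (isLittleO_const_id_atTop (1 : ℝ)).comp_tendsto tendsto_natCast_atTop_atTop
      simpa [Function.comp_def] using this
    simpa [Nat.cast_add] using ht.add h1
  have h := hcls k hk (fun n N g => ∃ T : DecisionTree N, T.depth ≤ t n ∧ ∀ x, g x = T.eval x)
    (fun n => t n + 1) hDo (fun n => Nat.succ_le_succ (Nat.zero_le _))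
    (Eventually.of_forall fun n N g hg => by
      obtain ⟨T, hT, hg⟩ := hg
      rw [tailWeight_decisionTree_eq_zero sgn T (fun x => by rw [hg x]) (Nat.lt_succ_of_le hT)]
      positivity) ε hε
  filter_upwards [h] with n hn j m hnj hm T hT
  exact hn j m hnj hm (fun v => (T v).eval) fun v => ⟨T v, hT v, fun _ => rfl⟩

end Summit.PneNP.PneNP.Theorems

end
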